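import Mathlib.NumberTheory.Divisors
import Mathlib.Data.Finsupp.Basic
import Mathlib.Algebra.BigOperators.Finsupp.Basic
import Mathlib.Analysis.SpecialFunctions.Log.Basic
import Mathlib.Tactic.Positivity
import Mathlib.Tactic.FieldSimp
import Mathlib.Tactic.Ring
import HarnessLib

/-!
# Coefficient-level diagonal main-term forms of the amplified mollified harmonic moments in
# `S₂(q)*` (Kowalski–Michel–VanderKam 2000, §4–§5) and the length-budget statement S-fam-02′

Topic `Literature/NumberTheory/LFunctions` (namespace
`Literature.NumberTheory.LFunctions.KMV2000`, the grouping sub-namespace of the paper, as in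
`KMVMollifiedMomentForms`). Typed for the LANDAU–SIEGEL PROGRAMME (cell `landau-siegel`, rung F-S3,
sub-cell §B-fam, upgrade item U1 of the planner's 2026-08-26T20:01:44Z list): the statement
**S-fam-02′** (REF-B3, `B-fam/REF.md` block 3 P3) «at equal expanded length, an amplified
(bilinear-weight) design of the untwisted mollified harmonic moments cannot beat the single
mollifier» typed over the DIAGONAL MAIN-TERM FORMS of the source for GENERAL coefficients. The
profile-level forms of the source ((30)–(33), mollifier shape `μ(m)ψ(m)⁻¹P(log(M/m)/log M)`) are
`KMV2000.linForm` / `secondMomentForm` / `ratio` (`KMVMollifiedMomentForms`); the forms below are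
their coefficient-level parents, which amplified designs need because an amplifier destroys the
`μ·P` shape. FRAMING (cell rule): the programme SEARCHES and TYPES; nothing here is a claim about
Landau–Siegel zeros.

## Source, read on the page (held text `paper:doi-10-1515-crll-2000-074`, 2026-08-26)

E. Kowalski, P. Michel, J. VanderKam, *Non-vanishing of high derivatives of automorphic
`L`-functions at the center of the critical strip*, J. reine angew. Math. **526** (2000) 1–34
[KowalskiMichelVanderKam2000]. Level `q` prime, harmonic weights, `Λ(f,s) = q̂^s Γ(s+½) L(f,s)`,
`q̂ = √q/2π`; Hecke recursion (10) p. 7 `λ_f(m)λ_f(n) = Σ_{d|(m,n)} λ_f(mn/d²)` ((`m n`, `q`) = 1);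
Petersson formula with the Kloosterman terms an error in the diagonal range (Lemma 3.3, p. 13
«we can replace the inner average over `f` by the Kronecker symbol `δ_{m₁n₁,m₂n₂}`»). With a
Dirichlet-polynomial weight `Σ_n z_n λ_f(n) n^{−1/2}` in place of `M_P(f)²` resp. `M_P(f)`, the
diagonal evaluations of §4 (first moment, Prop. 4.1 p. 12: main term from `Σ^h Λ(f,½)λ_f(n) n^{−1/2}
∝ 1/n`) and of §5 (second moment, (21)–(23) pp. 12–13: after `c = (m₁,m₂)`, the main term is the
`c`-sum `Σ_{c|(n₁,n₂)} c·τ(n₁n₂/c²)/(n₁n₂) × log-weight`, the log-weight being the residue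
`½ log(q̂²c²/(n₁n₂))` of the `W`-integral (22) at leading order) give the three forms below; the
normalisation constants `ζ(2)q̂^{1/2}…` / `2ζ(2)²q̂…` of Props. 4.1/5.1 cancel in the
Cauchy–Schwarz ratio and are dropped, as in the cell's evaluator conventions
(`B-fam` INBOX 2026-08-26T20:10:54Z, lineages A/B).

## What is typed here

* `heckeLin u v` — Hecke linearisation (10) in the `n^{−1/2}`-normalisation:
  `(Σ_a u_a λ(a)a^{−1/2})(Σ_b v_b λ(b)b^{−1/2}) = Σ_n (heckeLin u v)_n λ(n) n^{−1/2}`,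
  `(heckeLin u v)_n = Σ_{d|(a,b), ab = nd²} u_a v_b / d`;
* `kmvKernel logQ n₁ n₂ = (n₁n₂)^{−1} Σ_{c|(n₁,n₂)} c·τ(n₁n₂/c²)·(logQ + log c − ½log(n₁n₂))`
  (`logQ = log q̂`), the diagonal second-moment kernel of (23);
* for an amplifier `A_f = Σ_a α_a λ_f(a) a^{−1/2}` and a mollifier `M_f = Σ_m x_m λ_f(m) m^{−1/2}`:
  `mass α = Σ α_a²/a` (`= Σ^h A_f²` at main order), `firstForm α x = Σ_n (A²M)_n/n`
  (`∝ Σ^h A_f² M_f Λ(f,½)`), `secondForm logQ α x = Σ z_{n₁} z_{n₂} kmvKernel logQ n₁ n₂`,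
  `z = heckeLin α x` (`∝ Σ^h A_f² M_f² Λ(f,½)²`), and the amplified Cauchy–Schwarz ratio
  `ampRatio = firstForm² / (mass · secondForm)` = the main-order lower bound for the `ω_f A_f²`-weighted
  harmonic proportion of `Λ(f,½) ≠ 0` (all-forms scale; `= 2 ×` this on the even class);
  `A = 1` (`α = single 1 1`) is the single-mollifier ratio of the source (PROVED: `heckeLin_one_left`,
  `mass_one`, `ampRatio_one`);
* `AmplifiedLengthBudget Q₀ θ` — **S-fam-02′ (length-budget domination form), a DEFINITION WITH
  PARAMETERS, no instance asserted**: for `q̂ ≥ Q₀` and every amplified design whose first-moment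
  expanded length `(len A)²·len M` is `≤ q̂^θ`, some single mollifier of length `≤ len A · len M`
  (the design's second-moment half-length = the equal-budget comparison of REF-B3) has at least the
  same ratio. STATUS: NOT IN PRINT (our statement; nearest print: the source's single-mollifier
  optimum `Δ/(2(1+Δ))`, Thm 6.1 p. 20, and Čech–Matomäki arXiv:2501.12526 Remark 1.2 «proofs of
  optimality of mollifiers are very sparse»); EVIDENCE (float, not certified): cell probe kit j260808
  (22 support cells × 10 values of `q̂`, general real amplifier coefficients, exact pencil in `x`):
  domination holds in all 160 grid rows with `(len A)²·len M ≤ q̂` and `q̂ ≥ 30`, margins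
  `+0.003 … +0.060`; it FAILS outside that range (27/37 rows with `(len A)² len M > q̂`, e.g.
  `len A = len M = 8`, `q̂ = 64`: amplified `0.714` > single `0.670`) and at toy sizes
  (`len A = len M = 2`, `q̂ ≤ 11.3`), so the parameters are load-bearing: the instances the cell EXPECTS
  are `θ < 1` with `Q₀ = Q₀(θ)`, and `θ = 1, Q₀ = 30` is consistent with every probe row.
PROVED here: the unit/algebra of `heckeLin` needed to see that `A = 1` is the single mollifier, the
monotonicity of the statement in its parameters, and its trivial instance `θ ≤ 0` (no room for an
amplifier). WHAT THIS IS NOT: not an asymptotic statement about `S₂(q)*` (the identification of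
these forms with the moments is Props. 4.1/5.1 of the source in the range `Δ < 1`, typed at profile
level in `KMVMomentAsymptoticsBeyondDiagonal`); not a claim that any instance with `θ > 0` holds.

## References

* [KowalskiMichelVanderKam2000] (10) p. 7; Prop. 4.1 p. 12; (21)–(23) pp. 12–13; Prop. 5.1 p. 18;
  Thm. 6.1 (32) p. 20. [held: paper:doi-10-1515-crll-2000-074]
* [CechMatomaki2025] Remark 1.2 p. 4 (optimality proofs are sparse). [held: paper:arxiv-2501.12526]
-/

noncomputable section

open Finset

namespace Literature.NumberTheory.LFunctions.KMV2000

/-! ### Hecke linearisation -/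

/-- **Hecke linearisation** of a product of two Dirichlet-polynomial weights in the
`n^{−1/2}`-normalisation: `(Σ_a u_a λ(a)a^{−1/2})(Σ_b v_b λ(b)b^{−1/2}) = Σ_n w_n λ(n)n^{−1/2}` with
`w_n = Σ_{d | (a,b), ab = n d²} u_a v_b / d`, from `λ(a)λ(b) = Σ_{d|(a,b)} λ(ab/d²)`.
[cite: KowalskiMichelVanderKam2000, (10) p. 7 (derivation: coefficient bookkeeping)] -/
def heckeLin (u v : ℕ →₀ ℝ) : ℕ →₀ ℝ :=
  u.sum fun a ua => v.sum fun b vb =>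
    ∑ d ∈ (Nat.gcd a b).divisors, Finsupp.single (a / d * (b / d)) (ua * vb / d)

/-- The trivial weight `1 = λ(1)`: coefficient vector `single 1 1`.
[cite: KowalskiMichelVanderKam2000, (9) p. 7 («λ_f(1) = 1») (derivation: notation)] -/
abbrev one : ℕ →₀ ℝ := Finsupp.single 1 1

/-- `λ(1)·(Σ v_b λ(b) b^{−1/2}) = Σ v_b λ(b) b^{−1/2}`: the unit of the linearisation.
[cite: KowalskiMichelVanderKam2000, (10) p. 7 (derivation: the case `m = 1`)] -/
theorem heckeLin_one_left (v : ℕ →₀ ℝ) : heckeLin one v = v := by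
  unfold heckeLin one
  rw [Finsupp.sum_single_index]
  · simp only [Nat.gcd_one_left, Nat.divisors_one, Finset.sum_singleton, Nat.div_one, one_mul,
      Nat.cast_one, div_one]
    exact Finsupp.sum_single v
  · simp

/-- Symmetry of the linearisation in its two factors.
[cite: KowalskiMichelVanderKam2000, (10) p. 7 (derivation: `λ(a)λ(b) = λ(b)λ(a)`)] -/
theorem heckeLin_comm (u v : ℕ →₀ ℝ) : heckeLin u v = heckeLin v u := by
  unfold heckeLin
  rw [Finsupp.sum_comm]
  refine Finsupp.sum_congr fun b _ => Finsupp.sum_congr fun a _ => ?_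
  rw [Nat.gcd_comm]
  refine Finset.sum_congr rfl fun d _ => ?_
  rw [mul_comm (b / d), mul_comm (v b)]

/-- `(Σ u_a λ(a) a^{−1/2})·λ(1) = Σ u_a λ(a) a^{−1/2}`.
[cite: KowalskiMichelVanderKam2000, (10) p. 7 (derivation: the case `n = 1`)] -/
theorem heckeLin_one_right (u : ℕ →₀ ℝ) : heckeLin u one = u := by
  rw [heckeLin_comm, heckeLin_one_left]

/-- **Length** of a coefficient vector: the largest index in its support (`0` for the zero vector).
[cite: KowalskiMichelVanderKam2000, (9) p. 7 («`m < M`», `M = q̂^Δ`) (derivation: notation)] -/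
def len (u : ℕ →₀ ℝ) : ℕ := u.support.sup id

/-- A coefficient vector is a **design vector** when it is non-zero and not supported at the
meaningless index `0`.
[cite: KowalskiMichelVanderKam2000, (9) p. 7 (derivation: notation)] -/
def IsDesign (u : ℕ →₀ ℝ) : Prop := u ≠ 0 ∧ 0 ∉ u.support

/-- Homogeneity in the amplifier's constant: `(c·λ(1))·V = c·V`.
[cite: KowalskiMichelVanderKam2000, (10) p. 7 (derivation: the case `m = 1`, scaled)] -/
theorem heckeLin_single_one_left (c : ℝ) (v : ℕ →₀ ℝ) :
    heckeLin (Finsupp.single 1 c) v = c • v := by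
  unfold heckeLin
  rw [Finsupp.sum_single_index]
  · simp only [Nat.gcd_one_left, Nat.divisors_one, Finset.sum_singleton, Nat.div_one, one_mul,
      Nat.cast_one, div_one]
    calc (v.sum fun b vb => Finsupp.single b (c * vb))
        = v.sum fun b vb => c • Finsupp.single b vb := by
          refine Finsupp.sum_congr fun b _ => ?_
          rw [Finsupp.smul_single, smul_eq_mul]
      _ = c • v.sum Finsupp.single := by rw [Finsupp.smul_sum]
      _ = c • v := by rw [Finsupp.sum_single]
  · simp

/-- The support of a linearised product lies below the product of the lengths:
every index of `heckeLin u v` is `a/d · b/d ≤ a·b` for some `a ∈ supp u`, `b ∈ supp v`.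
[cite: KowalskiMichelVanderKam2000, (10) p. 7 (derivation: `mn/d² ≤ mn`)] -/
theorem mem_support_heckeLin {u v : ℕ →₀ ℝ} {n : ℕ} (hn : n ∈ (heckeLin u v).support) :
    ∃ a ∈ u.support, ∃ b ∈ v.support, ∃ d ∈ (Nat.gcd a b).divisors, n = a / d * (b / d) := by
  unfold heckeLin at hn
  obtain ⟨a, ha, hn⟩ := Finset.mem_biUnion.mp (Finsupp.support_sum hn)
  obtain ⟨b, hb, hn⟩ := Finset.mem_biUnion.mp (Finsupp.support_sum hn)
  obtain ⟨d, hd, hn⟩ := Finset.mem_biUnion.mp (Finsupp.support_finsetSum hn)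
  exact ⟨a, ha, b, hb, d, hd, (Finset.mem_singleton.mp (Finsupp.support_single_subset hn))⟩

/-- **Length is sub-multiplicative under linearisation**: `len (A·M) ≤ len A · len M` — the
linearised product `A M` is a single weight of length at most the product of the lengths (the
budget bookkeeping of S-fam-02′: the comparison mollifier `A·M` is admissible).
[cite: KowalskiMichelVanderKam2000, (10) p. 7 (derivation: `mn/d² ≤ mn`)] -/
theorem len_heckeLin_le (u v : ℕ →₀ ℝ) : len (heckeLin u v) ≤ len u * len v := by
  unfold len
  refine Finset.sup_le fun n hn => ?_
  obtain ⟨a, ha, b, hb, d, hd, rfl⟩ := mem_support_heckeLin hn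
  have ha' : a ≤ u.support.sup id := Finset.le_sup (f := id) ha
  have hb' : b ≤ v.support.sup id := Finset.le_sup (f := id) hb
  calc a / d * (b / d) ≤ a * b := Nat.mul_le_mul (Nat.div_le_self a d) (Nat.div_le_self b d)
    _ ≤ u.support.sup id * v.support.sup id := Nat.mul_le_mul ha' hb'

/-! ### The diagonal kernel and the three forms -/

/-- **The diagonal second-moment kernel** `K(n₁,n₂) = (n₁n₂)^{−1} Σ_{c|(n₁,n₂)} c·τ(n₁n₂/c²)·
(logQ + log c − ½ log(n₁n₂))` (`logQ = log q̂`; `½log(q̂²c²/(n₁n₂))` is the leading-order residue of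
the `W`-integral of (22) on the diagonal (23)): `Σ^h Λ(f,½)² λ_f(n₁)λ_f(n₂)(n₁n₂)^{−1/2}` at main
order, up to the constant `2q̂`.
[cite: KowalskiMichelVanderKam2000, (21)–(23) pp. 12–13 and Prop. 5.1 p. 18 (derivation: general coefficients, leading log-weight)] -/
def kmvKernel (logQ : ℝ) (n₁ n₂ : ℕ) : ℝ :=
  (∑ c ∈ (Nat.gcd n₁ n₂).divisors,
      (c : ℝ) * ((n₁ / c * (n₂ / c)).divisors.card : ℝ) *
        (logQ + Real.log c - (Real.log n₁ + Real.log n₂) / 2)) / ((n₁ : ℝ) * n₂)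

/-- **Amplified harmonic mass** `Σ^h A_f² = Σ_a α_a²/a` at main order (Petersson diagonal).
[cite: KowalskiMichelVanderKam2000, Lemma 3.3 p. 8 and (4) p. 6 (derivation: diagonal of `Σ^h λ(a)λ(a')`)] -/
def mass (α : ℕ →₀ ℝ) : ℝ := α.sum fun a c => c ^ 2 / a

/-- **Amplified first-moment form** `Σ_n (A²M)_n / n`: the main term of `Σ^h A_f² M_f Λ(f,½)`
(up to `ζ(2)q̂^{1/2}`-type constants), from `Σ^h Λ(f,½)λ_f(n)n^{−1/2} ∝ 1/n` (the source's §4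
evaluation) applied to the linearised weight `A²M = heckeLin (heckeLin α α) x`.
[cite: KowalskiMichelVanderKam2000, Prop. 4.1 p. 12 (derivation: general coefficients)] -/
def firstForm (α x : ℕ →₀ ℝ) : ℝ := (heckeLin (heckeLin α α) x).sum fun n c => c / n

/-- **Amplified second-moment form** `Σ_{n₁,n₂} z_{n₁} z_{n₂} K(n₁,n₂)`, `z = heckeLin α x` the
linearised weight `A·M`: the main term of `Σ^h A_f² M_f² Λ(f,½)²` (up to `2ζ(2)²q̂`-type constants).
[cite: KowalskiMichelVanderKam2000, (23) p. 13 and Prop. 5.1 p. 18 (derivation: general coefficients)] -/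
def secondForm (logQ : ℝ) (α x : ℕ →₀ ℝ) : ℝ :=
  (heckeLin α x).sum fun n₁ c₁ => (heckeLin α x).sum fun n₂ c₂ => c₁ * c₂ * kmvKernel logQ n₁ n₂

/-- **Amplified Cauchy–Schwarz ratio** `firstForm² / (mass · secondForm)`: the main-order lower
bound «`Σ^h_{Λ(f,½) ≠ 0} ≥ L²/Q`» (p. 6) run with the weights `ω_f A_f²` (all-forms scale).
[cite: KowalskiMichelVanderKam2000, p. 6 («`Σ^h_{Λ^{(k)}(f,½)≠0} 1 ≥ L(x)²/Q(x)`») and Thm. 6.1 (32) p. 20 (derivation: amplified weights)] -/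
def ampRatio (logQ : ℝ) (α x : ℕ →₀ ℝ) : ℝ :=
  firstForm α x ^ 2 / (mass α * secondForm logQ α x)

/-! ### `A = 1` is the single mollifier -/

/-- `Σ^h 1 = 1` at main order: the mass of the trivial amplifier.
[cite: KowalskiMichelVanderKam2000, (4) p. 6 (derivation)] -/
theorem mass_one : mass one = 1 := by
  unfold mass one
  rw [Finsupp.sum_single_index] <;> simp

/-- With the trivial amplifier the first form is the single-mollifier linear form `Σ_n x_n/n`… of the
linearised `M` itself: `firstForm 1 x = Σ_n x_n / n`.
[cite: KowalskiMichelVanderKam2000, Prop. 4.1 p. 12 (derivation: `A = 1`)] -/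
theorem firstForm_one (x : ℕ →₀ ℝ) : firstForm one x = x.sum fun n c => c / n := by
  unfold firstForm
  rw [heckeLin_one_left, heckeLin_one_left]

/-- With the trivial amplifier the second form is the single-mollifier quadratic form
`Σ x_{n₁}x_{n₂} K(n₁,n₂)`.
[cite: KowalskiMichelVanderKam2000, Prop. 5.1 p. 18 (derivation: `A = 1`)] -/
theorem secondForm_one (logQ : ℝ) (x : ℕ →₀ ℝ) :
    secondForm logQ one x = x.sum fun n₁ c₁ => x.sum fun n₂ c₂ => c₁ * c₂ * kmvKernel logQ n₁ n₂ := by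
  unfold secondForm
  rw [heckeLin_one_left]

/-- **The single-mollifier ratio is the `A = 1` amplified ratio**: `ampRatio logQ 1 x =
(Σ x_n/n)² / Σ x x K` — so the supremum of `ampRatio` over amplified designs of any budget is at
least the single-mollifier supremum at the same length (the trivial direction of S-fam-02′).
[cite: KowalskiMichelVanderKam2000, Thm. 6.1 (32) p. 20 (derivation: `A = 1`)] -/
theorem ampRatio_one (logQ : ℝ) (x : ℕ →₀ ℝ) :
    ampRatio logQ one x =
      (x.sum fun n c => c / n) ^ 2 /
        (x.sum fun n₁ c₁ => x.sum fun n₂ c₂ => c₁ * c₂ * kmvKernel logQ n₁ n₂) := by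
  unfold ampRatio
  rw [mass_one, firstForm_one, secondForm_one, one_mul]

/-- Homogeneity: scaling the trivial amplifier does not change the ratio,
`ampRatio (c·1) x = ampRatio 1 x` for `c ≠ 0` (`firstForm` scales by `c²`, `mass` by `c²`,
`secondForm` by `c²`).
[cite: KowalskiMichelVanderKam2000, Thm. 6.1 (32) p. 20 (derivation: the ratio is scale-free)] -/
theorem ampRatio_single_one (logQ c : ℝ) (hc : c ≠ 0) (x : ℕ →₀ ℝ) :
    ampRatio logQ (Finsupp.single 1 c) x = ampRatio logQ one x := by
  have hlin : heckeLin (Finsupp.single 1 c) (Finsupp.single 1 c) = Finsupp.single 1 (c * c) := by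
    rw [heckeLin_single_one_left, Finsupp.smul_single, smul_eq_mul]
  have hmass : mass (Finsupp.single 1 c) = c ^ 2 := by
    unfold mass; rw [Finsupp.sum_single_index] <;> simp
  have hfirst : firstForm (Finsupp.single 1 c) x = (c * c) * firstForm one x := by
    unfold firstForm
    rw [hlin, heckeLin_single_one_left, heckeLin_one_left, heckeLin_one_left,
      Finsupp.sum_smul_index fun _ => by simp, Finsupp.mul_sum]
    refine Finsupp.sum_congr fun n _ => ?_
    ring
  have hsecond : secondForm logQ (Finsupp.single 1 c) x = (c * c) * secondForm logQ one x := by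
    unfold secondForm
    rw [heckeLin_single_one_left, heckeLin_one_left, Finsupp.sum_smul_index fun _ => by simp,
      Finsupp.mul_sum]
    refine Finsupp.sum_congr fun n₁ _ => ?_
    rw [Finsupp.sum_smul_index fun _ => by simp, Finsupp.mul_sum]
    refine Finsupp.sum_congr fun n₂ _ => ?_
    ring
  unfold ampRatio
  rw [hmass, hfirst, hsecond, mass_one, one_mul]
  have hc2 : c * c ≠ 0 := mul_ne_zero hc hc
  field_simp

/-- A design vector has length at least `1`.
[cite: KowalskiMichelVanderKam2000, (9) p. 7 (derivation: notation)] -/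
theorem IsDesign.one_le_len {u : ℕ →₀ ℝ} (h : IsDesign u) : 1 ≤ len u := by
  obtain ⟨a, ha⟩ := Finsupp.support_nonempty_iff.mpr h.1
  have ha0 : a ≠ 0 := fun h0 => h.2 (h0 ▸ ha)
  exact (Nat.one_le_iff_ne_zero.mpr ha0).trans (Finset.le_sup (f := id) ha)

/-- A design vector of length `1` is a non-zero multiple of `λ(1)`.
[cite: KowalskiMichelVanderKam2000, (9) p. 7 (derivation: notation)] -/
theorem IsDesign.eq_single_of_len_eq_one {u : ℕ →₀ ℝ} (h : IsDesign u) (h1 : len u = 1) :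
    u = Finsupp.single 1 (u 1) ∧ u 1 ≠ 0 := by
  have hsub : u.support ⊆ {1} := by
    intro a ha
    have hle : a ≤ 1 := h1 ▸ (Finset.le_sup (f := id) ha)
    have ha0 : a ≠ 0 := fun h0 => h.2 (h0 ▸ ha)
    exact Finset.mem_singleton.mpr (le_antisymm hle (Nat.one_le_iff_ne_zero.mpr ha0))
  have hu : u = Finsupp.single 1 (u 1) := Finsupp.eq_single_iff.mpr ⟨hsub, rfl⟩
  refine ⟨hu, fun h0 => h.1 ?_⟩
  rw [hu, h0, Finsupp.single_zero]

/-- The trivial design `λ(1)` is a design vector.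
[cite: KowalskiMichelVanderKam2000, (9) p. 7 (derivation: notation)] -/
theorem isDesign_one : IsDesign one :=
  ⟨by simp [one], by simp [one]⟩

/-! ### S-fam-02′: the length-budget statement -/

/-- **S-fam-02′ (amplified length budget, domination form) with parameters `Q₀, θ`.**
`AmplifiedLengthBudget Q₀ θ` says: for every `q̂ ≥ Q₀` (`logQ = log q̂`) and every pair of design
vectors `α` (amplifier `A`) and `x` (mollifier `M`) whose first-moment expanded length obeys
`(len α)²·(len x) ≤ q̂^θ`, there is a single mollifier `x'` of length `len x' ≤ len α · len x`
(= the half-length of the design's second moment `(AM)²`, REF-B3's equal-budget comparison) with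
`ampRatio logQ α x ≤ ampRatio logQ 1 x'`. NOT IN PRINT and not a theorem — the cell's statement (REF-B3,
`B-fam/REF.md` block 3 P3: «after head mollification the Cauchy–Schwarz deficiency lives in the tail
primes; an amplifier on head primes cannot reduce tail variance, on tail primes it IS mollifier
length»), typed as a definition with parameters; NO instance is asserted here. Expected
instances: every `θ < 1` with some `Q₀ = Q₀(θ)`; float evidence (kit j260808, not certified) is
consistent with `θ = 1, Q₀ = 30` and REFUTES `θ > 1` and `(θ, Q₀) = (1, 8)` (see the module
docstring). If an instance with `θ` covering the cell's in-range amplified class is proved, that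
class joins the single-mollifier class of the B-fam word BY THEOREM (REF-B3 acceptance (α),
2026-08-26T20:36:21Z).
[cite: KowalskiMichelVanderKam2000, Thm. 6.1 p. 20 with Props. 4.1/5.1 (the forms); CechMatomaki2025, Remark 1.2 p. 4 (no optimality statement of this kind in print) (derivation: cell statement S-fam-02′; definition with parameters, no instance asserted)] -/
def AmplifiedLengthBudget (Q₀ θ : ℝ) : Prop :=
  ∀ logQ : ℝ, Real.log Q₀ ≤ logQ →
    ∀ α x : ℕ →₀ ℝ, IsDesign α → IsDesign x →
      ((len α : ℝ) ^ 2 * (len x : ℝ) ≤ Real.exp (θ * logQ)) →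
        ∃ x' : ℕ →₀ ℝ, IsDesign x' ∧ len x' ≤ len α * len x ∧
          ampRatio logQ α x ≤ ampRatio logQ one x'

/-- Monotonicity of S-fam-02′ in its parameters: a larger threshold `Q₀` and a smaller exponent `θ`
give a weaker statement.
[cite: KowalskiMichelVanderKam2000, Thm. 6.1 p. 20 (derivation: bookkeeping of the cell statement)] -/
theorem AmplifiedLengthBudget.mono {Q₀ Q₀' θ θ' : ℝ} (h : AmplifiedLengthBudget Q₀ θ)
    (hQ : 1 ≤ Q₀) (hQ' : Q₀ ≤ Q₀') (hθ : θ' ≤ θ) : AmplifiedLengthBudget Q₀' θ' := by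
  intro logQ hlog α x hα hx hlen
  have hlog' : Real.log Q₀ ≤ logQ :=
    (Real.log_le_log (lt_of_lt_of_le one_pos hQ) hQ').trans hlog
  have h0 : 0 ≤ logQ := (Real.log_nonneg hQ).trans hlog'
  exact h logQ hlog' α x hα hx
    (hlen.trans (Real.exp_le_exp.mpr (mul_le_mul_of_nonneg_right hθ h0)))

/-- **The trivial instance `θ ≤ 0`**: with no room for an amplifier (`(len A)²·len M ≤ 1` forces
`A = c·λ(1)`, `M = x₁·λ(1)`), the amplified ratio IS a single-mollifier ratio. A sanity check of
the typed shape, not evidence for the expected instances `0 < θ < 1`.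
[cite: KowalskiMichelVanderKam2000, Thm. 6.1 p. 20 (derivation: degenerate case of the cell statement)] -/
theorem amplifiedLengthBudget_of_nonpos {Q₀ θ : ℝ} (hQ : 1 ≤ Q₀) (hθ : θ ≤ 0) :
    AmplifiedLengthBudget Q₀ θ := by
  intro logQ hlog α x hα hx hlen
  have h0 : 0 ≤ logQ := (Real.log_nonneg hQ).trans hlog
  have hexp : Real.exp (θ * logQ) ≤ 1 :=
    Real.exp_le_one_iff.mpr (mul_nonpos_of_nonpos_of_nonneg hθ h0)
  have h1 : ((len α : ℝ)) ^ 2 * (len x : ℝ) ≤ 1 := hlen.trans hexp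
  have hα1 := hα.one_le_len
  have hx1 := hx.one_le_len
  have hlenα : len α = 1 := by
    by_contra hne
    have h2 : (2 : ℝ) ≤ len α := by exact_mod_cast (lt_of_le_of_ne hα1 (Ne.symm hne))
    have h3 : (1 : ℝ) ≤ len x := by exact_mod_cast hx1
    nlinarith
  have hlenx : len x = 1 := by
    by_contra hne
    have h2 : (2 : ℝ) ≤ len x := by exact_mod_cast (lt_of_le_of_ne hx1 (Ne.symm hne))
    have h3 : (1 : ℝ) ≤ len α := by exact_mod_cast hα1
    nlinarith
  obtain ⟨hαeq, hc⟩ := hα.eq_single_of_len_eq_one hlenα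
  refine ⟨x, hx, by rw [hlenα, one_mul], ?_⟩
  rw [hαeq, ampRatio_single_one logQ (α 1) hc x]

end Literature.NumberTheory.LFunctions.KMV2000
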